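import Summits.BirchSwinnertonDyer.BirchSwinnertonDyer.Theorems.ThetaPartnerAtTwoSignedKatoUpToAtTwoLayerPoitouTateWeil
import Summits.BirchSwinnertonDyer.BirchSwinnertonDyer.Theorems.ThetaPartnerAtTwoSignedKatoUpToAtTwoLayerGlobalShapiro
import Summits.BirchSwinnertonDyer.BirchSwinnertonDyer.Theorems.ThetaPartnerAtTwoSignedKatoUpToAtTwoLayerPairingPk
import Literature.NumberTheory.EllipticCurves.BSDConductorProofs
import HarnessLib

/-!
# Route `ThetaPartnerAtTwo` (TP2), crux K3 `SignedKatoDivisibilityUpToAtTwo` (item stmt-BirchSwinnertonDyer-20308) /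
# K3P′ (item 25631), line `colemanrat` v8 — (PT-orth) AT A FINITE LAYER AND LEVEL: the registered stub `stub_ptOrthLayerTwo`, PROVED

Lead `bsd-wall-tp2-p2x` g5 (cell `bsd-wall`). HONEST FRAMING: THEOREMS ONLY (no definition, no named fact, no instance, no `sorry`);
this file proves the registered stub `stub_ptOrthLayerTwo` (S2 = (PT-orth)) of the v8 skeleton of line `colemanrat`
(`Cruxes/SignedKatoDivisibilityUpToAtTwo/Lines/colemanrat.lean`, sha16 7465880b40c5a36d) BY ITS REGISTERED SIGNATURE; it does NOT close
the crux (the other registered stub `stub_layerSideNoPTTwo` carries the published input (ES)+(ERL♭) of [Kato2004] and stays open);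
BSD is NOT proved by any of this.

## The statement (`p = 2`, `v ∣ 2`, `κ` the cyclotomic `ℤ₂`-extension of `ℚ`)
For every `Γ_ℚ`-equivariant biadditive `μ_{2^k}`-valued family `e_k` on `E[2^k]` compatible in the level
(`e_{k+1}(S', T') = e_k(2S', T')` for `T' = T ∈ E[2^k]`), every layer `N`, level `L₀`, class `x ∈ H¹(Γ_N, T₂E)`, every layer Selmer
class `t ∈ Sel_{2^∞}(E/ℚ_N)` with a cocycle `φ_N` killed by `2^{L₀}` whose restriction to `U_N = Gal(ℚ̄_v/ℚ_{N,v})` is the Kummer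
cocycle of a point `Q' ∈ E(ℚ̄_v)` with `2^{L₀} Q' ∈ E(ℚ_{N,v})`:

  `2 • ⟨red_{2^{L₀}} x, 2^{L₀} Q'⟩_{N, 2^{L₀}} = 0`   (`LayerPairing.layerPairingPk`, the (D-layer) finite layer pairing).

## Proof (assembly of landed bricks; Kobayashi (7.16)–(7.21) / Kato §17.13 at finite level, `m = 1` forced by the real places)
1. finite-level lifts `ψ_L : Γ_N → E[2^L]` of `φ_N` for all `L ≥ L₀` (`LayerFinite.exists_torsionCocycle_of_zsmul_eq_zero`);
2. Poitou–Tate over `ℚ` in the Shapiro model for the Weil cup classes `Sh(red_{2^{L₀}} x) ∪_{Σe} Sh[ψ_{L₀}]`, with the level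
   transport discharged (`LayerPTW2.two_nsmul_localInvariantMap_weilShapiroCup_eq_zero` = the lead's
   `LayerPT.two_nsmul_localInvariantMap_cup_shapiroLift_eq_zero` ∘ w2's `Kato2004.shapiroCup_weil_htrans_reduceH1Pk`): SH-VANISH at every
   `v' ∤ 2∞`, Tate reciprocity, real places `2`-torsion ⇒ `2 • inv_v(loc_v(…)) = 0` at the unique `v ∣ 2`;
3. one orbit at `v ∣ 2` (`2` totally ramified in `ℚ_∞`): `inv_v(loc_v(…))` IS the layer pairing value
   (`LayerPairing.invAt_localization_cupProduct_shapiroLift_layer`), once `loc_N[ψ_{L₀}]` is recognised as the layer Kummer class of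
   `2^{L₀}Q'` (`LayerPairing.layerKummer_eq_oneCocycleClass`).
The multi-step level compatibility of `e_k` is derived from the one-step clause by induction; the re-typing
`E[(2:ℤ)^L] = E[((2^L : ℕ) : ℤ)]` is the identity.

## What is proved
* `ePk_levelCompat` — one-step ⇒ multi-step compatibility of the family `e_k`.
* `mapH1AddHom_id_apply` — `(id)_* = id` on `H¹`.
* `not_two_mem_of_ne` — `v` is the only finite place of `ℚ` above `2`.
* `stub_ptOrthLayerTwo` — the registered stub, verbatim.

References: [Kobayashi2003] (7.16)–(7.21) (p. 12), (8.23) (p. 18); [Kato2004Asterisque] §17.13 (p. 279); [MilneADT2006] Ch. I,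
Thm. 4.10 (b), Ex. 1.6 (c), §6 proof of Prop. 6.9; [NeukirchSchmidtWingberg2008] I §5–§6; [SilvermanAEC2009] III §8, VIII §2.
-/

set_option autoImplicit false
-- the Theorems namespace of this sub repeats the summit name by design (D-0017 nested layout)
set_option linter.dupNamespace false

noncomputable section

open scoped Classical NumberField

namespace Summit.BirchSwinnertonDyer.BirchSwinnertonDyer.Theorems

namespace SignedKatoOffTwo.LayerPTFinal

open CategoryTheory NumberField IsDedekindDomain Field WeierstrassCurve ContinuousCohomology
  Literature.NumberTheory.GaloisRepresentations Literature.NumberTheory.GaloisRepresentations.DiscreteGaloisModule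
  Literature.NumberTheory.EllipticCurves Literature.NumberTheory.EllipticCurves.GreenbergSelmer
  Literature.NumberTheory.EllipticCurves.Kobayashi2003 Literature.NumberTheory.EllipticCurves.Kato2004
  Literature.NumberTheory.EllipticCurves.Kato2004.EulerSystemValues Literature.NumberTheory.EllipticCurves.Sprung2012
  Literature.NumberTheory.GaloisCohomology ZpExtension

/-! ## §1 Three small lemmas -/

/-- **One-step ⇒ multi-step level compatibility** of a family `e_k` on `E[2^k]`: if `e_{k+1}(S', T') = e_k(S, T)` whenever
`S = 2S'` and `T' = T`, then `e_L(S', T') = e_k(S, T)` whenever `k ≤ L`, `S = 2^{L-k} S'` and `T' = T` (induction on `L`, through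
the intermediate points `2S' ∈ E[2^L]`, `T' ∈ E[2^L]`). [cite: SilvermanAEC2009, Prop. III.8.1(e)] -/
theorem ePk_levelCompat (W : WeierstrassCurve ℚ) [W.IsElliptic]
    (ePk : ∀ k : ℕ, geomTorsion W (2 ^ k) → geomTorsion W (2 ^ k) → AlgebraicClosure ℚ)
    (hstep : ∀ (k : ℕ) (S' : geomTorsion W (2 ^ (k + 1))) (S : geomTorsion W (2 ^ k)) (T' : geomTorsion W (2 ^ (k + 1)))
      (T : geomTorsion W (2 ^ k)), (S : W.geomPoints) = (2 : ℤ) • (S' : W.geomPoints) →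
      (T' : W.geomPoints) = (T : W.geomPoints) → ePk (k + 1) S' T' = ePk k S T)
    (k : ℕ) (S T : geomTorsion W (2 ^ k)) :
    ∀ (L : ℕ), k ≤ L → ∀ (S' T' : geomTorsion W (2 ^ L)),
      (S : W.geomPoints) = (2 : ℤ) ^ (L - k) • (S' : W.geomPoints) → (T' : W.geomPoints) = (T : W.geomPoints) →
      ePk L S' T' = ePk k S T := by
  refine Nat.le_induction (fun S' T' hS hT ↦ ?_) (fun L hkL ih S' T' hS hT ↦ ?_)
  · rw [Nat.sub_self, pow_zero, one_smul] at hS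
    have h1 : S' = S := Subtype.ext hS.symm
    have h2 : T' = T := Subtype.ext hT
    subst h1 h2
    rfl
  · -- the intermediate points `2 • S' ∈ E[2^L]` and `T' ∈ E[2^L]`
    have hS1 : (2 : ℤ) • (S' : W.geomPoints) ∈ geomTorsion W (2 ^ L) := by
      refine (Submodule.mem_torsionBy_iff _ _).mpr ?_
      have h := (Submodule.mem_torsionBy_iff _ _).mp S'.2
      rwa [smul_smul, ← pow_succ]
    have hT1 : (T' : W.geomPoints) ∈ geomTorsion W (2 ^ L) := by
      refine (Submodule.mem_torsionBy_iff _ _).mpr ?_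
      have h := (Submodule.mem_torsionBy_iff _ _).mp T.2
      obtain ⟨d, rfl⟩ := Nat.exists_eq_add_of_le hkL
      rw [hT, pow_add, mul_comm, mul_smul, h, smul_zero]
    rw [hstep L S' ⟨_, hS1⟩ T' ⟨_, hT1⟩ rfl rfl]
    refine ih ⟨_, hS1⟩ ⟨_, hT1⟩ ?_ hT
    change (S : W.geomPoints) = (2 : ℤ) ^ (L - k) • ((2 : ℤ) • (S' : W.geomPoints))
    rw [hS, smul_smul, ← pow_succ, Nat.sub_add_comm hkL]

/-- `(id)_* = id` on `H¹` (functoriality of `mapH1AddHom` at the identity). [cite: SerreGaloisCohomology1997, I §2.2] -/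
theorem mapH1AddHom_id_apply {G : Type} [Group G] [TopologicalSpace G] [IsTopologicalGroup G] (X : TopRep.{0} ℤ G)
    (c : continuousCohomology 1 X) :
    mapH1AddHom X X (AddMonoidHom.id X) continuous_id (fun _ _ ↦ rfl) c = c := by
  obtain ⟨φ, rfl⟩ := oneCocycleClass_surjective X c
  rw [mapH1AddHom_oneCocycleClass]
  congr 1

/-- `v ∣ 2` is the ONLY finite place of `ℚ` above `2`. [folklore] -/
theorem not_two_mem_of_ne (v : HeightOneSpectrum (𝓞 ℚ)) (hv : ((2 : ℕ) : 𝓞 ℚ) ∈ v.asIdeal) :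
    ∀ v' : HeightOneSpectrum (𝓞 ℚ), v' ≠ v → ((2 : ℕ) : 𝓞 ℚ) ∉ v'.asIdeal := by
  intro v' hne hv'
  rw [natCast_mem_asIdeal_iff_eq_primesEquiv_symm _ Nat.prime_two] at hv hv'
  exact hne (hv'.trans hv.symm)

/-! ## §2 The registered stub `stub_ptOrthLayerTwo` (S2 = (PT-orth) at a finite layer and level) -/

/-- **(PT-orth) at a finite layer and level** — the registered stub `stub_ptOrthLayerTwo` of the v8 skeleton of line `colemanrat`
(crux K3, item stmt-BirchSwinnertonDyer-20308; twin K3P′ 25631), verbatim: for every compatible `Γ_ℚ`-equivariant biadditive family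
`e_k : E[2^k] × E[2^k] → μ_{2^k}`, layer `N`, level `L₀`, `x ∈ H¹(Γ_N, T₂E)`, layer Selmer class `t` with cocycle `φ_N` killed by
`2^{L₀}` and restricting on `U_N` to the Kummer cocycle of `Q'` (`2^{L₀}Q' ∈ E(ℚ_{N,v})`):
`2 • ⟨red_{2^{L₀}} x, 2^{L₀}Q'⟩_{N,2^{L₀}} = 0`. Proof: module docstring (lifts `ψ_L`; Poitou–Tate over `ℚ` in the Shapiro model with
level transport; one orbit at `v ∣ 2`; recognition of the layer Kummer class). [cite: Kobayashi2003, (7.16)–(7.21) (p. 12), (8.23) (p. 18)]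
[cite: Kato2004Asterisque, §17.13 (p. 279)] [cite: MilneADT2006, Ch. I, Thm. 4.10(b), Ex. 1.6 (c)] -/
theorem stub_ptOrthLayerTwo :
    ∀ (v : HeightOneSpectrum (𝓞 ℚ)), ((2 : ℕ) : 𝓞 ℚ) ∈ v.asIdeal →
    ∀ (W : WeierstrassCurve ℚ) [W.IsElliptic] [ContinuousSMul ℤ_[2] (W.tateModule 2)]
      (κ : ZpExtension ℚ 2), κ.IsCyclotomic →
    ∀ (ePk : ∀ k : ℕ, geomTorsion W (2 ^ k) → geomTorsion W (2 ^ k) → AlgebraicClosure ℚ)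
      (hμ : ∀ k S T, ePk k S T ^ (2 ^ k) = 1)
      (hadd₁ : ∀ k S₁ S₂ T, ePk k (S₁ + S₂) T = ePk k S₁ T * ePk k S₂ T)
      (hadd₂ : ∀ k S T₁ T₂, ePk k S (T₁ + T₂) = ePk k S T₁ * ePk k S T₂)
      (hgal : ∀ k (σ : absoluteGaloisGroup ℚ) (S T : geomTorsion W (2 ^ k)), σ • ePk k S T = ePk k (σ • S) (σ • T)),
      (∀ (k : ℕ) (S' : geomTorsion W (2 ^ (k + 1))) (S : geomTorsion W (2 ^ k)) (T' : geomTorsion W (2 ^ (k + 1)))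
          (T : geomTorsion W (2 ^ k)), (S : W.geomPoints) = (2 : ℤ) • (S' : W.geomPoints) →
          (T' : W.geomPoints) = (T : W.geomPoints) → ePk (k + 1) S' T' = ePk k S T) →
    ∀ (N L₀ : ℕ) (x : H1 (tateRep W 2) (κ.layerSubgroup N))
      (t : W.subgroupH1 2 (κ.layerSubgroup N)), t ∈ W.selmerLayer κ N →
    ∀ (φN : contOneCocycles (discreteTopRep (κ.layerSubgroup N) (W.geomPrimaryTorsion 2))), oneCocycleClass _ φN = t →
      (∀ y, (2 ^ L₀ : ℕ) • ((φN.1 y : W.geomPrimaryTorsion 2) : W.geomPoints) = 0) →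
    ∀ (Q' : localPoints W (v.adicCompletion ℚ))
      (hP' : (2 ^ L₀ : ℕ) • Q' ∈ localLayerPointsOfEmb κ (closureEmb (K := ℚ) (v.adicCompletion ℚ)) W N),
      (∀ τ : localSubgroupOfEmb (κ.layerSubgroup N) (closureEmb (K := ℚ) (v.adicCompletion ℚ)),
        pointsMapOfEmb W (closureEmb (K := ℚ) (v.adicCompletion ℚ))
            ((φN.1 (resGalSubgroupOfEmb (κ.layerSubgroup N) _ τ) : W.geomPrimaryTorsion 2) : W.geomPoints) =
          (τ : absoluteGaloisGroup (v.adicCompletion ℚ)) • Q' - Q') →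
      2 • LayerPairing.layerPairingPk W κ v ePk hμ hadd₁ hadd₂ hgal N L₀ x ⟨(2 ^ L₀ : ℕ) • Q', hP'⟩ = 0 := by
  intro v hv W _ _ κ hκ ePk hμ hadd₁ hadd₂ hgal hstep N L₀ x t ht φN hφN hkill Q' hP' hKum
  haveI : CompactSpace (absoluteGaloisGroup ℚ) := absoluteGaloisGroup_compactSpace ℚ
  haveI : (κ.layerSubgroup N).FiniteIndex := finiteIndex_of_isOpen_of_compactSpace _ (κ.isOpen_layerSubgroup N)
  haveI : Fintype (absoluteGaloisGroup ℚ ⧸ κ.layerSubgroup N) := Fintype.ofFinite _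
  obtain ⟨s, hs, hs1⟩ := exists_reps_one (κ.layerSubgroup N)
  -- (1) finite-level lifts `ψ_L : Γ_N → E[2^L]` of `φ_N`, `L ≥ L₀`
  have hφL : ∀ L : ℕ, L₀ ≤ L → ∀ y, ((2 ^ L : ℕ) : ℤ) • ((φN.1 y : W.geomPrimaryTorsion 2) : W.geomPoints) = 0 := by
    intro L hL y
    obtain ⟨d, rfl⟩ := Nat.exists_eq_add_of_le hL
    rw [natCast_zsmul, pow_add, mul_nsmul, hkill y, nsmul_zero]
  choose ψ hψ using fun (L : ℕ) (hL : L₀ ≤ L) ↦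
    LayerFinite.exists_torsionCocycle_of_zsmul_eq_zero W 2 (κ.layerSubgroup N) ((2 ^ L : ℕ) : ℤ) φN (hφL L hL)
  -- (2) Poitou–Tate over `ℚ` in the Shapiro model, level transport discharged (lead T2 ∘ w2 htrans)
  have hPT := LayerPTW2.two_nsmul_localInvariantMap_weilShapiroCup_eq_zero W κ N hs hs1 v (not_two_mem_of_ne v hv) ht φN
    hφN L₀ ψ hψ ePk hμ hadd₁ hadd₂ hgal
    (fun L hL α β hα hβ S' T ↦ ePk_levelCompat W ePk hstep L₀ (α S') T L hL S' (β T) (hα S') (hβ T))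
    (fun L ↦ AddMonoidHom.id (geomTorsion W ((2 : ℤ) ^ L))) (fun _ ↦ continuous_id) (fun _ _ _ ↦ rfl) (fun _ _ ↦ rfl) x
  -- (3) one orbit at `v ∣ 2`: the local term is the layer pairing value, via the layer Kummer class of `2^{L₀} Q'`
  have hb : LayerPairing.layerLoc W (2 ^ L₀) κ v N (oneCocycleClass _ (ψ L₀ le_rfl)) =
      LayerPairing.layerKummer W (2 ^ L₀) κ v N ⟨(2 ^ L₀ : ℕ) • Q', hP'⟩ := by
    symm
    rw [LayerPairing.layerLoc, map_oneCocycleClass]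
    refine LayerPairing.layerKummer_eq_oneCocycleClass W (2 ^ L₀) κ v N ⟨(2 ^ L₀ : ℕ) • Q', hP'⟩ Q' (natCast_zsmul _ _) _
      fun τ ↦ ?_
    have e1 := hψ L₀ le_rfl (resGalSubgroupOfEmb (κ.layerSubgroup N) (closureEmb (K := ℚ) (v.adicCompletion ℚ)) τ)
    rw [← hKum τ, ← e1]
    rfl
  have hT3 := LayerPairing.invAt_localization_cupProduct_shapiroLift_layer W (2 ^ L₀) (ePk L₀) (hμ L₀) (hadd₁ L₀) (hadd₂ L₀)
    (hgal L₀) κ v hκ hv N hs hs1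
    (mapH1AddHom (subgroupRep (W.torsionGaloisModule ((2 : ℤ) ^ L₀)).toTopRep (κ.layerSubgroup N))
      (subgroupRep (W.torsionGaloisModule ((2 ^ L₀ : ℕ) : ℤ)).toTopRep (κ.layerSubgroup N))
      (AddMonoidHom.id (geomTorsion W ((2 : ℤ) ^ L₀))) continuous_id (fun _ _ ↦ rfl)
      (reduceH1Pk W 2 L₀ (κ.layerSubgroup N) x))
    (oneCocycleClass _ (ψ L₀ le_rfl)) ⟨(2 ^ L₀ : ℕ) • Q', hP'⟩ hb
  have key : 2 • LayerPairing.layerPairingMod W (2 ^ L₀) (ePk L₀) (hμ L₀) (hadd₁ L₀) (hadd₂ L₀) (hgal L₀) κ v N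
      (mapH1AddHom (subgroupRep (W.torsionGaloisModule ((2 : ℤ) ^ L₀)).toTopRep (κ.layerSubgroup N))
        (subgroupRep (W.torsionGaloisModule ((2 ^ L₀ : ℕ) : ℤ)).toTopRep (κ.layerSubgroup N))
        (AddMonoidHom.id (geomTorsion W ((2 : ℤ) ^ L₀))) continuous_id (fun _ _ ↦ rfl)
        (reduceH1Pk W 2 L₀ (κ.layerSubgroup N) x)) ⟨(2 ^ L₀ : ℕ) • Q', hP'⟩ = 0 := by
    rw [← hT3]
    exact hPT
  have ha : mapH1AddHom (subgroupRep (W.torsionGaloisModule ((2 : ℤ) ^ L₀)).toTopRep (κ.layerSubgroup N))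
      (subgroupRep (W.torsionGaloisModule ((2 ^ L₀ : ℕ) : ℤ)).toTopRep (κ.layerSubgroup N))
      (AddMonoidHom.id (geomTorsion W ((2 : ℤ) ^ L₀))) continuous_id (fun _ _ ↦ rfl)
      (reduceH1Pk W 2 L₀ (κ.layerSubgroup N) x) = reduceH1Pk W 2 L₀ (κ.layerSubgroup N) x :=
    mapH1AddHom_id_apply _ _
  rw [ha] at key
  exact key

end SignedKatoOffTwo.LayerPTFinal

end Summit.BirchSwinnertonDyer.BirchSwinnertonDyer.Theorems

end
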